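import Summits.BirchSwinnertonDyer.BirchSwinnertonDyer.Theorems.KolyvaginRoadThreeZhangInductionOn
import Summits.BirchSwinnertonDyer.BirchSwinnertonDyer.Theorems.KolyvaginRoadThreeMethod2Defs
import Summits.BirchSwinnertonDyer.BirchSwinnertonDyer.Theorems.KolyvaginRoadThreeMethod2ParityRank
import Summits.BirchSwinnertonDyer.BirchSwinnertonDyer.Theorems.KolyvaginRoadThreeMethod2StubA
import Summits.BirchSwinnertonDyer.BirchSwinnertonDyer.Theorems.KolyvaginRoadThreeMethod2LevelSystems
import Summits.BirchSwinnertonDyer.BirchSwinnertonDyer.Theorems.KolyvaginRoadThreeMethod2RungsByName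
import Summits.BirchSwinnertonDyer.BirchSwinnertonDyer.Theorems.KolyvaginRoadThreePTEngineUnconditional
import Summits.BirchSwinnertonDyer.BirchSwinnertonDyer.Theses.KolyvaginRoadThree
import Summits.BirchSwinnertonDyer.Rank1Residual.X11b.Three.KolyvaginLine
import Literature.NumberTheory.EllipticCurves.HeegnerPointsOfConductorRationality
import Literature.NumberTheory.EllipticCurves.KolyvaginShaStructureDivisibility

/-! v3.2 (OWNER delivery, bsd-stepL-koly g20, 2026-08-27 — THE PT ROAD CLOSED). v3.1 (registered 3aa7b9adabcbc8fa) AFTER the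
landing of Milne *ADT* I Thm. 4.10(b) for `E[3]` as a THEOREM and of the E[3]-specific S2-ENGINE chain:
* stub PT `stub_poitouTateSelmerStructureDuality` (the ∀-module named fact `poitouTate_selmerStructure_duality K`) is DELETED:
  the line consumed it only AT the module `E[3]` (Howard 2.1.11 at `ρ = E[3]`), and that instance is now the theorem
  `KolyvaginRoadThreePT.selmerComplementAt_canonical_torsionGaloisModule` (koly g20 p576866) = koly3b g10's
  `PTAt.selmerComplementAt_canonical_of_middleExact` (p574201) ∘ koly g20's **`middleExact_canonical_of_card_eq_sq`** (p574551:
  Milne I 4.10(b) for THE invariant maps, UNCONDITIONALLY, for every finite discrete Γ_K-module of order p² killed by an odd p —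
  dévissage over the p-Sylow fixed field (g18 `middleExact_canonical_of_unipotentTwo_all`) + the prime-to-p descent (g19 certificate
  `middleExact_canonical_of_descentData`, its nine binders theorems: semi-local Mackey formulas p565938, degree/unramified/places
  p559560/p560412, adjointness p572508 via `cores = Shapiro cor` p571515 + projection formula + `Prop121vii.invLevel_corMu`));
* S2-ENGINE `stub_inductionOfLevelSystemsAtThree` is DERIVED FROM THEOREMS ONLY: `:= PTAt.stub_inductionOfLevelSystemsAtThree_holds`
  (koly3b g10 part 7 `…PTEngineUnconditional`: the registered text with NO named hypothesis — twins of XVIII/XXII/XXV/Engine with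
  `hPT ↦ hE3`, `hE3 := middleExact_canonical_torsionGaloisModule`, rigidity p531202 inline); text VERBATIM v3.
`lean check` target: rc 0, sorries = EXACTLY P (`stub_oddSelmerRankAtThree`, landed modulo the route binders h₁ + hCT3), S1
(`stub_bottomRankOneAtThree`), S2-KS (`stub_levelKolyvaginSystemsAtThree`) = 3; `ZhangSharpFrameAtThreeHL_of` byte-identical to
v3/v3.1 and concludes the crux BY NAME. Kernel twin of the terminal state: `PTAt.zhangSharpFrameAtThreeHL_of_routeBinders_of_bottom_
of_levelSystems'` (koly3b g10 part 7: crux BY NAME ⟸ h₁ + hCT3 + S1 + S2-KS — NO Poitou–Tate hypothesis anywhere in the line).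
Stub TEXTS of P ∕ S1 ∕ S2-KS ∕ A ∕ rungs and all history docstrings VERBATIM. -/

/-! v3.1 (OWNER delivery, bsd-stepL-koly g17, 2026-08-27 — plan g33 RULING 21 (B); NOT registered by the seat: first-refusal
delivery for the planner's `crux write` + `skeleton check`). v3 (registered 90adda8cb9c1bade) AFTER THE S2-ENGINE LANDING:
* the two BC5 rung stubs and stub A POINTED BY NAME to their landed theorems (p467727, p489918) — as in koly g15's pre-stage;
* NEW by-name PUB stub `stub_poitouTateSelmerStructureDuality` — Poitou–Tate global duality for Selmer structures (Howard 2004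
  Thm. 2.1.11 ∕ Milne *ADT* I Thm. 4.10(b) ∕ Rubin Thm. 1.7.3; tree fact `Literature.NumberTheory.GaloisCohomology.
  poitouTate_selmerStructure_duality`) at IMAGINARY QUADRATIC fields = the exact `hPT` binder of koly3b g6's landed
  `ZhangSupply.stub_inductionOfLevelSystemsAtThree_of_poitouTate_of_rigidity` (p532734); the input of W. Zhang's Lemma 8.2 =
  McCallum Prop. 2.1 ∕ Lemma 5.3 («Tate global duality … maximal isotropic»), on which the route's PUB binder
  `McCallum1991_pow_dvd_card_sha_primary_of_certificate` itself rests in print; in flight as a THEOREM in the cell bsd-schneider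
  (door-c4 ∕ door-c6: Milne I 4.10(b) via the global class formation — axioms I ∕ II landed 2026-08-27) and via the tree's
  `poitouTate_selmerStructure_duality_of_middleExact_canonical`; the line — not the route — displays this PUB debt (RULING 21 (B)(ii));
* the local line-rigidity at Kolyvagin primes (`hRig` of p532734; RULING 21 (B)(ii)'s «stub_ramifiedLineRigidity», Gross Prop.
  8.1–8.2 ∕ 9.6) became a THEOREM the same hour — zhang3-p1 g10 `KolyLocal.sub_zsmul_mem_torsionLocalKer_of_isotropic` (p531202) —
  so it is NOT carried as a stub (its cup-product statement would need local instance attributes in this file); it is fed inline;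
* S2-ENGINE `stub_inductionOfLevelSystemsAtThree` is NO LONGER A STUB: DERIVED from stub PT by p532734 + p531202 (= koly g17's
  `Method2CruxOfBinders.stub_inductionOfLevelSystemsAtThree_of_poitouTate`, p536191) — text VERBATIM v3's, so
  `stub_inductionRankGeThreeAtThree` and `ZhangSharpFrameAtThreeHL_of` are byte-identical to v3's.
`lean check`: rc 0, sorries = EXACTLY the open stubs P (`stub_oddSelmerRankAtThree`, landed modulo the route binders h₁ + hCT3,
p522478 — orientation (o1) stands), S1 (`stub_bottomRankOneAtThree`), S2-KS (`stub_levelKolyvaginSystemsAtThree`) and PT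
(`stub_poitouTateSelmerStructureDuality`) = 4; `ZhangSharpFrameAtThreeHL_of` concludes the crux BY NAME. Kernel twin of the
terminal state: `Method2CruxOfBinders.zhangSharpFrameAtThreeHL_of_routeBinders_of_poitouTate_of_bottom_of_levelSystems`
(koly g17: crux BY NAME ⟸ h₁ + hCT3 + hPT + S1 + S2-KS). Stub TEXTS of P ∕ S1 ∕ S2-KS ∕ A ∕ rungs and all history docstrings
VERBATIM. -/

/-! v3 = v2z WITH S2 RE-LINED (proposal of the seat bsd-stepL-zhang3-p1 g8, 2026-08-27, answering plan g30 03:49:37Z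
«S2 re-line … hand me the stub signatures»; NOT registered by the seat). v2z's RESIDUAL stub S2
`stub_inductionRankGeThreeAtThree` (Zhang's induction above the bottom, GIVEN (A1)) is CUT into exactly its two honest
parts, over the new tree vocabulary `Theorems/KolyvaginRoadThreeMethod2LevelSystems.lean` (zhang3-p1 g8:
`Method2.transverseLocalKer` = the TRANSVERSE local condition `H¹_tr` at a Kolyvagin prime in the tree's global
Gross-currency, and the structure `Method2.LevelKolyvaginSystem` = W. Zhang's level Kolyvagin systems as pinned-shape
data):
* S2-KS `stub_levelKolyvaginSystemsAtThree` (NEW, RESIDUAL — the R-c content and NOTHING else): at every HL A1 frame,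
  `Nonempty (LevelKolyvaginSystem W K Dt β ι c)` — classes `κ m n ∈ H¹(K, E[3])` at every GOOD level `n` (finite sets of
  unipotent-admissible primes) and Kolyvagin conductor `m` (finite sets of Zhang's Kolyvagin primes), PINNED at `n = ∅`
  to the frame's concrete Kolyvagin classes mod 3 (`realisation`), satisfying at every good NON-EMPTY level the
  KOLYVAGIN-SYSTEM AXIOMS for the level-`n` structure [Zhang §8.1 property (1) + (8.1): signs; E's Kummer condition off
  `m ∪ n` (= the conditions of `levelSelmerSubgroup`); ORDINARY on `n`; TRANSVERSE on `m`; `loc_ℓ κ(mℓ,n) = 0 ⟺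
  loc_ℓ κ(m,n) = 0`], the (A2) TRANSPORT along two good steps [Thm 4.3] and the (A5) BASE CASE at good non-empty even
  levels of canonical rank one [Thm 7.2] = W. Zhang §3 (level raising + Heegner points on `X_{N⁺,N⁻∏n}` + Euler-system
  relations) + Thm 4.3 + Thm 7.2 RUN AT `p = 3`: not in print; exactly the binders `κ`, `hcE`, `hcL`, `hcT`, `hfs`,
  `hA2`, `hA5` of the engine-of-KS `ZhangTriangulation.exists_ne_zero_of_zhangInduction_on_of_kolyvaginSystem_finite`
  (p493797) read in the model. JUNK ∕ COSTUME: `κ` above `∅` is constrained by the KS axioms at EVERY good non-empty level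
  (incl. the levels of rank ≥ 3 that S2's regime `dim Sel₃(E/K) ≥ 3` forces the induction to visit), by `relation`
  across conductors and by `transport` down to the PINNED bottom; a witness is a genuine Kolyvagin system for the
  level-`n` structure at every good level — not obtainable from a crux witness (v2x's B failed this test because its
  classes above `∅` were free; here they are tied to the level structure, the transverse condition and (8.1)).
* S2-ENGINE `stub_inductionOfLevelSystemsAtThree` (NEW, PROVABLE — the instantiation of the tree's engine): at every HL
  A1 frame, a `LevelKolyvaginSystem` + stub A's (A1) (hypothesis, as in S2) + odd `dim Sel₃(E/K) ≥ 3` ⟹ the crux's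
  conclusion. Road (all E-side, no level-raised object): the engine-of-KS `…_finite` (zhang3-p1 g8: NO finiteness posit —
  the relaxed Selmer group at the base locus is PROVED finite, p493507) on the PARITY-COHERENT good levels (koly g12
  `Method2CruxOfOddRank` idiom), its (A3) being koly3b's DERIVED triangulation (p481938 ∕ p493507); the level-INDEPENDENT
  inputs to be DISCHARGED in the model: the membership dictionaries `hSel` ∕ `hSelRel` ∕ `hB` ∕ `hLF` (unfolding
  `levelSelmerSubgroup` ∕ `baseLocusQ` through `galoisCohomology.localization` and the two-model comparison
  `Iso.exists_addMonoidHom_comp_localization_eq_torsionLocMap` + `torsionPointsMap_bijective`), (REC) = tree THEOREM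
  `poitouTate_sum_localTatePairing_eq_zero_of_isTotallyComplex` + `sum_inv_weilCupProduct_localization_eq_zero`,
  isotropy of the Kummer ∕ ordinary ∕ transverse conditions (tree: Poonen–Rains `KummerImageIsotropyProofs`, koly g13
  `IsoOrdinary`; transverse: inflation from a cyclic quotient), (Perf) ∕ (Line) at Kolyvagin primes (`H¹(K_λ,E[3]) =
  H¹_f ⊕ H¹_tr`, eigen-lines, `f^s × tr^s → 𝔽₃` perfect: local class field theory of `K_λ` + Weil pairing between
  opposite `τ`-eigenlines of `E[3]`), (Cheb) ×2 = McCallum Cor 3.2 for eigenclasses (tree kernel theorem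
  `McCallum1991_cor_3_2_pow_of_chebotarev` ∕ koly3b `ZhangTriangulationEigen`, modulo `chebotarev_artinRep` — PROVED —
  and `exists_weilPairing`), (Supply) = Zhang L.8.2 (koly3b g4 in flight over `LocalInvariants.SelmerComplement`),
  (A4) = `relaxation_le`, (A6) by parity coherence from stub P's oddness and (A1)'s bookkeeping.
* `stub_inductionRankGeThreeAtThree` is NO LONGER A STUB: it is PROVED below from S2-KS + S2-ENGINE (three lines), so
  `ZhangSharpFrameAtThreeHL_of` is byte-identical to v2z's. P ∕ S1 ∕ A (landed) ∕ rungs (landed) VERBATIM from v2z.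
`lean check`: rc 0, sorries = P, S1, S2-KS, S2-ENGINE + the 2 rung stubs carried by pointer; `ZhangSharpFrameAtThreeHL_of`
concludes the crux BY NAME. The ONE prerequisite the re-line needed and the tree lacked — a NAME for the transverse
condition at Kolyvagin primes — is `Method2.transverseLocalKer` (review lane, p496874). -/

/-! v2y = v2x RE-LINED ABOVE THE BOTTOM (planner bsd-stepL-plan g28, 2026-08-27, executing plan g27's RULING 23:40:43Z on
koly3b g2's STUB-B FINDING, evidence #38∕#39 `STUB-B-ABOVE-BOTTOM-19574.md`, kernel p471131 ∕ p471571 ∕ p471747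
`Method2.cruxAt_iff_consumedCoherent`). v2x's stub B `stub_kolyvaginClassesAtThree` FAILS the cell's junk test above the
bottom: its classes `κ m n` are pinned only at `n = ∅`, and GIVEN stubs A + P and a Poitou–Tate-true covering family the
part of B that `_of` consumed is EQUIVALENT to the crux's own conclusion frame by frame — B isolated no brick about
level-raised forms (none of W. Zhang's Thm 4.3 ∕ Lemma 8.4 ∕ Thm 7.2 at `p = 3`), only the crux in costume. B is EXPIRED
by this registration (nobody works it). REPAIR = koly3b's (R-e) + (R-a), plan g27: the ONE statement inside W. Zhang's
proof that the tree can type today WITHOUT level-raised objects is the rank-one base case AT THE BOTTOM, so the crux is cut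
by the 3-SELMER RANK OF `E/K` (odd by stub P):
* S1 `stub_bottomRankOneAtThree` (NEW, PINNED, load-bearing on the slice `dim_𝔽₃ Sel₃(E/K) = 1`): at an HL A1 frame with
  `dim_𝔽₃ Sel₃(E/K) = 1` the CONDUCTOR-1 Kolyvagin class `c(1) = δ(y_K)` is non-zero mod 3 — i.e. `3 ∤ [E(K) : ℤ y_K]`
  when `Ш(E/K)[3] = 0` (the witness is NAMED: `n = 1`, no derived classes; per-pair certificate = the Heegner index mod 3;
  NOT cheap from the crux, whose witness may have `n ≠ 1` — passing from some `c(n) ≢ 0` to `c(1) ≢ 0` is Kolyvagin's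
  structure theorem `M₀ = M_∞` at `Ш[3^∞] = 0`; in print at `p ≥ 5`: Zhang Thm 9.1∕Thm 1.1 at `r = 1` = one level-raising
  step + the rank-0 converse for the raised form (Thm 7.2, SU) + the first reciprocity law; at `p = 3 ∥ N` also reachable
  from the IMC-side divisibility of the sibling cruxes `HalvesTamAtThree` ∕ `IMCDivTwoLociTamAtThree`, and on A1 ∩ non-split-3
  from Schneider@3, koly3b g0 p456367);
* S2 `stub_inductionRankGeThreeAtThree` (NEW, RESIDUAL until the R-c objects exist — lit g14 typing
  `defn-ZhangLevelRaisedKolyvaginData`): at an HL A1 frame with `dim_𝔽₃ Sel₃(E/K)` odd and `≥ 3`, GIVEN stub A's (A1) rank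
  lowering at the frame (hypothesis — so A stays load-bearing and S2 is strictly weaker than «the crux on the slice»), the
  crux's conclusion: W. Zhang's induction ABOVE the bottom = (A2) cohomological congruences Thm 4.3 + (A3) triangulation
  Lemma 8.4 + (A5) base case Thm 7.2 for the LEVEL-RAISED forms `g_n`, `A_n[𝔭_n] ≅ E[3]`, classes `c(m,n)` — exactly the
  frames (the cell's TRUE-OPEN A1 pairs, where the conductor-1 certificate misses) at which the level-raised objects are
  unavoidable; its own line = A + Zhang's bricks over `ZhangLevelRaisedKolyvaginData` once typed;
* A `stub_levelRaisingAtThree` and P `stub_oddSelmerRankAtThree` VERBATIM from v2x (koly3a's ∕ koly g13's ∕ zhang3-p1's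
  helpers on A stand: p455830, p464695, p476141, (Iso) in flight); both §4 rungs VERBATIM (LANDED p467727);
* `_of : A → P → S1 → S2 → crux` sorry-free by the PARITY CASE SPLIT: `dim` odd (P) ⟹ `dim = 1` (S1, witness `n = 1`,
  `kolSupp_one`) or `dim ≥ 3` (S2 fed with A's (A1) and P's parity). (A3)@∅ no longer occurs anywhere (R-a). The engine
  `ZhangInductionOn` is not called by `_of` any more — it is S2's internal road (tree `Method2CruxOfOddRank`,
  `ZhangInductionOnPos`, `Method2ClassesFromBottom` remain the kit for S2's line).
JUNK ∕ COSTUME TEST: S1 has no free data beyond the conductor-1 datum (whose class is `δ(y_K)` for every choice) and is not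
implied cheaply by the crux; S2 has NO free data (its conclusion is the crux's at the frame) and does not give the crux
without S1 (the `dim = 1` frames) nor without A; neither S1 nor S2 gives the leaf. `lean check`: rc 0, sorries = the 4
open stubs A ∕ P ∕ S1 ∕ S2 + the 2 rung stubs (landed by name in `Theorems/KolyvaginRoadThreeMethod2RungsByName.lean`);
`ZhangSharpFrameAtThreeHL_of` concludes the crux BY NAME. (The two module docstrings that follow are v2x's history
record, VERBATIM — they describe the v2 data pinning and the expired stub B.) -/

/-! v2x = v2w with §4 = TWO rung stubs with CLOSED texts (PUB binders + one attested certificate package ⟹ the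
crux's instance): `stub_rung_347253a1` (name kept, text (a″) of zhang3-p1's RUNG-BY-NAME kit = the type of the fit
witness `rung_347253a1_of_cert`, non-split 3) and NEW `stub_rung_5709e1` (split 3, p463552) — both LANDABLE BY NAME;
stubs A ∕ P ∕ B and `_of` byte-identical to v2w (koly g12, 2026-08-26).

v2w = v2u WITH THE RANK-0 CONVERSE REMOVED FROM STUB A (bsd-stepL-koly g12, OWNER seat, 2026-08-26; integrates the
ACCEL seat koly3a's finding STATUS 18:55:40Z ∕ evidence #29 `STUB-A-PARITY-ONLY-19574.md`, kernel p462319): W. Zhang's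
induction consumes the non-vanishing of the Selmer rank (A6⁰) ONLY at the levels it VISITS, and along the descent
`n ↦ n ∪ {q₁, q₂}` the total rank drops by EXACTLY 2 ((A1)'s (9.1)–(9.2) bookkeeping), so the ODDNESS of the bottom rank
`dim_𝔽₃ Sel₃(E/K)` propagates to every visited level and (A6⁰) there is free. Hence stub A no longer carries (A6⁰)
(«rank ≠ 0 at every good even level», sourced at `p = 3 ∥ N` to the memo chain R-SU3 + B♭ for LEVEL-RAISED forms); a
NEW small stub `stub_oddSelmerRankAtThree` asks the 3-PARITY of `Sel₃(E/K)` at the frame instead — PRINT-reachable: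
`rank E(K) = 1` and `Ш(E/K)` finite (Gross–Zagier–Kolyvagin on a Hoffstein–Luo frame), `dim_𝔽₃ Ш(E/K)[3]` even
(Cassels–Tate, tree `even_finrank_modN_primaryComponent_sha`), `E(K)[3] = 0` (ρ̄ onto). The composition `_of` runs
zhang3-p1's RELATIVISED engine `ZhangInductionOn.exists_ne_zero_of_zhangInduction_on_of_rank_ne_zero` (p455609) on the
PARITY-COHERENT GOOD levels `Good n := GoodLevel W K n ∧ (Odd (rank n) ↔ Even #n)`: (A1) on good levels produces such
levels (rank −1, cardinality +1), the engine's (A6⁰) is read off the coherence, and `Good ∅` is exactly the new stub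
(through the eigen-dictionary `finrank_selmer_eq_finrank_selQ_add`, zhang3-p1 p457405, and `algEquiv_mul_self_eq_one`,
koly g12 p462965). The deep `p = 3 ∥ N` content of the crux (level-raised forms: (A2) Thm 4.3, (A3) Lemma 8.4, (A5)
Thm 7.2 = the rank-ONE converse) now sits ENTIRELY in stub B; stub A = Poitou–Tate see-saw + sign-refined Čebotarev at
non-scalar u-admissible primes (koly3a's (Cheb)(Equiv)(Line)(Trans)(Iso) reduction, p455830 ∕ Method2RankLowering, to
be read with `FrobSqNeOneAt W 3 q` on every prime involved). FOUR stubs: `stub_levelRaisingAtThree` ((A1) on good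
levels — v2u's first conjunct VERBATIM), `stub_oddSelmerRankAtThree` (NEW), `stub_kolyvaginClassesAtThree` (v2u
VERBATIM), `stub_rung_347253a1` (VERBATIM).

v2u = v2t RELATIVISED TO GOOD LEVELS (bsd-stepL-koly g12, OWNER seat, 2026-08-26; repair (R3) of
`koly/STUB-MISSTATED-3-19574-scalar.md`). THIRD SIGNATURE REPAIR: v2t's `stub_levelRaisingAtThree` was STILL FALSE at
every HL frame, because `IsUAdmissiblePrime` (trace ±2, det 1 mod 3) also admits primes with SCALAR residual Frobenius
`ρ̄(Frob_q) = ±1` (2 of the 18 det-1 non-zero-trace classes of GL₂(𝔽₃)); at such a `q₀` the inert place `v ∣ q₀` has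
`Frob_v = 1` on `E[3]`, `H¹(K_v, E[3])` is 4-dimensional and sign-isotypic, and `ordinaryLocalKer = ⊤`, so the level
`{q₀, …}` RELAXES the Selmer structure and (A1) «rank lowering with codimension exactly one at some new prime» fails for
every non-zero class of `SelQ {q₁⁰,…,q_k⁰} μ` (Poitou–Tate see-saw: the dual structure is strict at the `q_i⁰`, its
`μ`-Selmer group vanishes for `k` large by Čebotarev, hence at every non-scalar `q` of sign `μ` the relaxed image is all
of `H¹(K_q, E[3])` and `SelQ (insert q n) μ ⊄ SelQ n μ`). REPAIR: every stub quantifier over levels `n` is RELATIVISED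
to GOOD levels `GoodLevel W K n` (:= every `q ∈ n` has `Frob_q² ≠ 1` on `E[3]`, tree `Method2.FrobSqNeOneAt`, landed
with `GoodLevel` in `Theorems/KolyvaginRoadThreeMethod2Defs.lean`, koly g12 p460483 ✓), (A1) PRODUCES a good prime,
(A2) runs along two good steps, (A3)∕(A5)∕(A6⁰) speak at good even levels, and `_of` calls zhang3-p1's RELATIVISED engine
`ZhangInductionOn.exists_ne_zero_of_zhangInduction_on_of_rank_ne_zero` (p455609 ✓) with `GoodLevel W K ∅`
(`goodLevel_empty`). On good levels every local condition of `levelSelmerSubgroup` is a Lagrangian line and (A1) is the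
honest see-saw (Zhang Prop. 5.4) + the sign-refined Čebotarev supply of u-admissible primes (koly MEMO-v2 U3:
`x((σg)²) ∈ x(g²) + (1 + μ ε_q u)·E[3]`, all of `E[3]` iff `ε_q = μ`). Stub NAMES, the realisation identity, the rung,
`relaxation_le` (via the tree) and `exists_algEquiv_ne_one` are unchanged; stub TEXTS = v2t + the `GoodLevel` binders.

v2t = v2s with the DATA IMPORTED (bsd-stepL-zhang3-p1 g5, 2026-08-26): §0 (local copies of the Literature
definition `WeierstrassCurve.ordinaryLocalKer`, landed p450980) and §1 (the canonical spaces `V3`, `IsUAdmissiblePrime`,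
`sgn`, `levelSelmerSubgroup`, `SelQ`, `SelRelQ`, `baseLocusQ`) and the proved (A4) lemma `relaxation_le` now live in
the TREE module `Theorems/KolyvaginRoadThreeMethod2Defs.lean` (p456348 ✓, namespace
`Summit.BirchSwinnertonDyer.Rank1Residual.X11b.Three.Koly.Method2`, opened below) — so a stub can be LANDED BY NAME from a
`Theorems/` file that imports the same module (a Cruxes skeleton is not importable). Stub TEXTS unchanged from v2s.

v2s = REPAIRED COPY (bsd-stepL-zhang3-p1 g5, 2026-08-26) of the REGISTERED planner copy
`plan/KOLYv2/Lines-method2r-19574.lean` (sha16 c7cb64088fb8d948 = koly g11's `Lines-method2-19574.lean` + §4 rung).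
TWO SIGNATURE REPAIRS (both registered stubs were FALSE as stated; see HOME/zhang3/STUB-MISSTATED-19574-method2.md):
(R1) `stub_levelRaisingAtThree` asked `∀ n S μ, FiniteDimensional (SelRelQ n S μ)` for EVERY relaxation set `S` of
     unipotent-admissible primes — false for infinite `S` (relaxing E[3]-classes at infinitely many admissible places is
     infinite-dimensional: Tate's global Euler characteristic + Poitou–Tate, `dim ≥ #S' + 2 − C` for finite `S' ⊆ S`).
     REPAIR: the finiteness conjunct is DROPPED from stub A; the one finiteness the induction needs (the relaxed
     `−s`-eigenspace of Lemma 8.4 (3)) moves INTO stub B's (A3), and `_of` runs the finiteness-in-(A3) engine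
     `ZhangInductionOn.exists_ne_zero_of_zhangInduction_fin_of_rank_ne_zero` (zhang3-p1 g5, Theorems/…ZhangInductionOn).
(R2) `baseLocusQ κ n` was «every κ m n satisfies the KUMMER (finite) condition at q» — but every Selmer-type class is
     Kummer at every admissible `q ∉ n`, so `B n ⊇ (all u-admissible primes) ∖ n`, `SelRelQ n (B n)` is relaxed almost
     everywhere and INFINITE-dimensional, and (A3)'s `SelQ n s = SelRelQ n (B n) s` fails for every κ at every level
     carrying a non-zero class (in particular at `n = ∅` whenever the crux holds at the frame) — stub B was false.
     REPAIR: Zhang's Definition 8.3 VERBATIM — `q` is a base point iff `loc_q κ = 0`, i.e. every `κ m n` lies in the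
     tree's `torsionLocalKer` (localisation ZERO in `H¹(K_q, E[3])`) at the place above `q`; for `q ∈ n` the two
     readings agree (`H¹_fin ∩ H¹_ord = 0`), for `q ∉ n` only this one is Zhang's. With it Lemma 8.4 (3) holds as
     printed for any size of `B(κ)` (the global-duality sum has zero local terms at base points).
Everything else (§0 local defs, §1 canonical spaces, `IsUAdmissiblePrime`, stub names, the §4 rung VERBATIM,
`relaxation_le`, `exists_algEquiv_ne_one`) is koly g11's text unchanged. `lean check`: 3 sorries = 3 stubs;
`ZhangSharpFrameAtThreeHL_of` sorry-free, concludes the crux BY NAME. -/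


/-!
# METHOD skeleton v2 for crux item stmt-BirchSwinnertonDyer-19574 `ZhangSharpFrameAtThreeHL` — DATA PINNED
# (route-BirchSwinnertonDyer-KolyvaginRoadThree; cell `bsd-stepL`, seat `bsd-stepL-koly` g11; plan g25 KOLY-(1),
# judge chip `skeleton-is-locus-split`, plan g25 13:08:12Z «COSTUME» ruling on the unpinned one-stub drafts)

v1 (`Lines-method-19574.lean`, koly g11; zhang3's `Lines-method-19574.lean`) had ONE stub «∃ Zhang datum», which
trivial data satisfy given the crux (plan g25: B ≡ ∅, κ ≡ 1) — a costume. Here EVERYTHING of W. Zhang's datum is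
PINNED to arithmetic except the classes of the level-raised forms at levels `n ≠ ∅`, and the six input shapes of
the engine `ZhangInduction.exists_ne_zero_of_zhangInduction_of_rank_ne_zero` (zhang3-p1 p446019 ✓ + p446227 ✓)
split into TWO GENUINE stubs ((A4) being definitional and PROVED):

* coefficient field `F := ZMod 3`, ambient space `H := V := H¹(K, E[3])` ITSELF (tree `galH1Torsion`; its unique
  `ZMod 3`-module structure enters as an instance binder — `3 · H¹(K, E[3]) = 0`, tree `zsmul_discreteH1_torsion`);
* admissible primes `Q := {q // IsUAdmissiblePrime W K q}` (unipotent-admissible at p = 3: prime, `q ∤ 3 N d_K`,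
  inert in K, `q ≡ 1 (mod 3)`, `3 ∤ a_q`; koly MEMO-v1∕v2);
* the LEVEL-RAISED eigen-Selmer spaces `Sel n ± ⊂ H¹(K, E[3])` DEFINED WITHOUT any abelian variety `A_n`, by LOCAL
  CONDITIONS: E's Kummer condition `selmerLocalKer` at every finite place not above `n` and at ∞, and at the place
  above `q ∈ n` the ORDINARY condition `ordinaryLocalKer` (§0 = the object of the definition item D-KZ1-lite,
  `koly/skel/OrdinaryLocalCondition.lean`: the local class is represented by a cocycle valued in
  `E[3]^{Γ_{K_q}} = ker N`, the toric line of every form raised at a unipotent-admissible `q` — Bertolini–Darmon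
  2005 §2.2 `H¹_ord`; W. Zhang 2014 §4.1; at `q` the −ε_q-eigenclasses are locally trivial, so imposing the
  condition on both eigenspaces is faithful); relaxed versions `SelRel n S ±` (no condition above `S`);
* the base locus `B n := {q | every class κ m n has localisation ZERO at q}` DEFINED from κ (Zhang Def. 8.3; v2s (R2));
* the bottom classes `κ m ∅ := d.kolyvaginClass Nat.prime_three 1` — an IDENTITY inside `H¹(K, E[3])`, `m = (n, d)`
  the Kolyvagin-supported Kolyvagin–Heegner data of the frame.

STUBS (each a statement about TRUE arithmetic objects; neither follows cheaply from the crux):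
* `stub_levelRaisingAtThree` — (A1) RANK LOWERING by raising the level at ONE unipotent-admissible prime, with the
  (9.1)–(9.2) eigen-bookkeeping, for the canonical spaces [Zhang Prop. 5.4 + Thm 2.1 + Čebotarev ∕ at p = 3: koly
  U1–U5 (kernel p396512, p396956, p397122, p398313), L-St, Lemma N, Gross–Parson duality]; + (A6⁰) the total
  canonical Selmer rank at an even admissible level is non-zero [Zhang Thm 7.1 + sign −1 ∕ R-SU3 + B♭]. κ-FREE: no
  class of a level-raised form occurs. (v2s: no finiteness conjunct — repair (R1).)
* `stub_kolyvaginClassesAtThree` — ∃ classes `κ m n ∈ H¹(K,E[3])` at admissible levels extending the CONCRETE bottom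
  classes, with (A2) CONGRUENCE TRANSPORT for the κ-defined base locus [Zhang Thm 4.3 ∕ at 3: G1∕G2 = MS21 6.8 +
  Helm Rem 8.12 + Tilouine 3.4, Lemma T], (A3) TRIANGULATION [Lemma 8.4; p-uniform print] and (A5) BASE CASE
  [Thm 7.2 ∕ R-SU3 + B♭ + Jochnowitz@3]. (B is a FUNCTION of κ, so (A2) cannot be vacated by B ≡ ∅.)
* (A4) RELAXATION `Sel n s ≤ SelRel (n ∪ {q}) S s` for `q ∈ S` is NOT a stub: it is TRUE BY DEFINITION of the
  canonical spaces and PROVED here (`relaxation_le`, unfolding the `iInf`s).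
COMPOSITION `ZhangSharpFrameAtThreeHL_of` (sorry-free, SEQUENTIAL): at each HL frame, produce complex conjugation
`c ≠ 1` of K (|Aut K| = 2), the `ZMod 3`-structure on H¹(K,E[3]), feed the canonical `Sel ∕ SelRel`, the stubbed κ
and `B := baseLocus κ` to the engine, read off `κ m ∅ ≠ 0` = a non-zero concrete Kolyvagin class.
JUNK TEST: (A1) demands, for every non-zero TRUE eigen-Selmer class of E∕K (and of every canonical level), a
unipotent-admissible q whose ordinary condition kills it with codimension exactly one — not obtainable from a crux
witness; (A2)∕(A3)∕(A5) quantify over κ but speak about the canonical spaces and a κ-defined B. Crux ⟹ stubs is NOT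
cheap (needs Čebotarev at u-admissible primes, global duality, …), stubs ⟹ crux is the engine. BC3 floor 2 met.
`lean check`: rc 0, exactly 3 sorries (`stub_levelRaisingAtThree`, `stub_kolyvaginClassesAtThree`, the §4 rung);
`ZhangSharpFrameAtThreeHL_of` concludes the crux BY NAME.
-/

noncomputable section

open scoped Classical

namespace Summit.BirchSwinnertonDyer.BirchSwinnertonDyer.Cruxes.ZhangSharpFrameAtThreeHL.Method2

open WeierstrassCurve NumberField IsDedekindDomain CategoryTheory
  Literature.NumberTheory.EllipticCurves Literature.NumberTheory.EllipticCurves.ModularForms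
  Literature.NumberTheory.GaloisRepresentations Module

open Summit.BirchSwinnertonDyer.Rank1Residual.X11b.Three.Koly.Method2
open Summit.BirchSwinnertonDyer.Rank1Residual.X11b.Three.Koly (PDiv)

/-! ## §2 The stubs -/

/-- **stub A — RANK LOWERING BY UNIPOTENT-ADMISSIBLE LEVEL RAISING AT 3** ((A1) of the engine, for the CANONICAL
spaces, on GOOD levels; κ-free; NO modular form is needed for it). At every Hoffstein–Luo A1 frame, for complex
conjugation `c ≠ 1` and the `ZMod 3`-structure of `H¹(K, E[3])`: every non-zero class of `Sel_n^μ` (n a GOOD finite set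
of unipotent-admissible primes: `Frob_q² ≠ 1` on `E[3]` for every `q ∈ n`) is killed by passing to `Sel_{n ∪ {q}}^μ` for
some NEW good unipotent-admissible `q`, with `Sel_{n∪q}^μ ≤ Sel_n^μ` of codimension exactly one and
`Sel_{n∪q}^{−μ} = Sel_n^{−μ}` [Zhang Prop. 5.4 = the Poitou–Tate see-saw between the self-dual structures `F_n`,
`F_{nq}` + (9.1)–(9.2); Čebotarev with the sign rule (Zhang L.7.3 ∕ BD05 Thm 3.2; at 3: koly MEMO-v2 U3,
`x((σg)²) ∈ x(g²) + (1 + μ ε_q u)·E[3]`); koly3a's kernel reduction p455830 to (Cheb)(Equiv)(Line)(Trans)(Iso), each to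
be read at primes with `FrobSqNeOneAt W 3 q`]. (History: v2r also asked finiteness of every relaxed space — false, (R1);
v2t asked (A1) at levels with scalar-Frobenius primes, where `ordinaryLocalKer = ⊤` — false, (R3); v2u also asked
(A6⁰) «rank ≠ 0 at every good even level» — true but idle above the visited levels and memo-grade at 3; replaced by the
3-parity stub `stub_oddSelmerRankAtThree` (koly3a, p462319).) -/
theorem stub_levelRaisingAtThree :
    ∀ (W : WeierstrassCurve ℚ) [W.IsElliptic] [W.IsGloballyMinimal] [NeZero (W.conductorNorm ℤ)] (K : Type)
      [Field K] [NumberField K] (Dt : ModularParametrizationData W (W.conductorNorm ℤ)) (β : ℤ) (ι : K →+* ℂ),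
      Summit.BirchSwinnertonDyer.Rank1Residual.ClassX11b W 3 → W.HasMultiplicativeReductionAtPrime 3 →
      Rank1Residual.Surj W 3 → Rank1Residual.Ram W 3 → ¬ 3 ∣ W.tamagawaProduct → IsImaginaryQuadratic K →
      Odd (NumberField.discr K) → SatisfiesHeegnerHypothesis (W.conductorNorm ℤ) K →
      (W.quadraticTwist (NumberField.discr K : ℚ)).entireLFunction 1 ≠ 0 → NumberField.discr K ≠ -3 →
      (4 * (W.conductorNorm ℤ : ℤ)) ∣ β ^ 2 - NumberField.discr K → ¬ (3 : ℤ) ∣ Dt.c →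
      ∀ (c : K ≃ₐ[ℚ] K), c ≠ 1 → ∀ [Module (ZMod 3) (V3 W K)],
      -- (A1) rank lowering at one new GOOD (non-scalar) unipotent-admissible prime, on good levels, (9.1)–(9.2)
      (∀ (n : Finset {q // IsUAdmissiblePrime W K q}) (μ : Bool) (x : V3 W K),
        GoodLevel W K n → x ∈ SelQ W K c n μ → x ≠ 0 →
        ∃ q : {q // IsUAdmissiblePrime W K q}, q ∉ n ∧ GoodLevel W K (insert q n) ∧
          x ∉ SelQ W K c (insert q n) μ ∧
          SelQ W K c (insert q n) μ ≤ SelQ W K c n μ ∧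
          finrank (ZMod 3) (SelQ W K c (insert q n) μ) + 1 = finrank (ZMod 3) (SelQ W K c n μ) ∧
          SelQ W K c (insert q n) (!μ) = SelQ W K c n (!μ)) :=
  -- LANDED p489918 (koly g13): `Summit.BirchSwinnertonDyer.Rank1Residual.X11b.Three.Koly.Method2StubA.stub_levelRaisingAtThree`
  Summit.BirchSwinnertonDyer.Rank1Residual.X11b.Three.Koly.Method2StubA.stub_levelRaisingAtThree

/-- **stub P — 3-PARITY OF `Sel₃(E/K)` AT A HOFFSTEIN–LUO A1 FRAME** (replaces v2u's (A6⁰) conjunct of stub A; the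
ACCEL seat koly3a's observation, kernel p462319: the induction needs the non-vanishing of the rank only at VISITED levels,
where it follows from the oddness at the bottom). At every HL A1 frame `dim_𝔽₃ Sel₃(E/K)` is ODD: `rank E(K) = 1` and
`Ш(E/K)` is finite [Gross–Zagier + Kolyvagin on an HL frame: `r_an(E/K) = r_an(E) + r_an(E^{d_K}) = 1 + 0`],
`dim_𝔽₃ Ш(E/K)[3]` is even [Cassels–Tate; tree `even_finrank_modN_primaryComponent_sha`], `E(K)[3] = 0` [ρ̄ onto
GL₂(𝔽₃), `K ≠ ℚ(√−3)`]; equivalently the 3-parity theorem over `ℚ` for `E` and `E^{d_K}` (Dokchitser–Dokchitser ∕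
Nekovář ∕ Monsky; tree `p_parity`, `even_selmerRank_sub_torsionRank_iff`) with `Sel₃(E/K) = Sel₃(E/ℚ) ⊕ Sel₃(E^{d_K}/ℚ)`.
The `ZMod 3`-structure on `H¹(K, E[3])` is an instance binder (all such structures agree). [cite: GrossLMS1991, §10
(Prop. 2.3)] [cite: WZhang2014, Thm. 9.2] -/
theorem stub_oddSelmerRankAtThree :
    ∀ (W : WeierstrassCurve ℚ) [W.IsElliptic] [W.IsGloballyMinimal] [NeZero (W.conductorNorm ℤ)] (K : Type)
      [Field K] [NumberField K] (Dt : ModularParametrizationData W (W.conductorNorm ℤ)) (β : ℤ) (ι : K →+* ℂ),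
      Summit.BirchSwinnertonDyer.Rank1Residual.ClassX11b W 3 → W.HasMultiplicativeReductionAtPrime 3 →
      Rank1Residual.Surj W 3 → Rank1Residual.Ram W 3 → ¬ 3 ∣ W.tamagawaProduct → IsImaginaryQuadratic K →
      Odd (NumberField.discr K) → SatisfiesHeegnerHypothesis (W.conductorNorm ℤ) K →
      (W.quadraticTwist (NumberField.discr K : ℚ)).entireLFunction 1 ≠ 0 → NumberField.discr K ≠ -3 →
      (4 * (W.conductorNorm ℤ : ℤ)) ∣ β ^ 2 - NumberField.discr K → ¬ (3 : ℤ) ∣ Dt.c →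
      ∀ [Module (ZMod 3) (V3 W K)],
      Odd (finrank (ZMod 3)
        (AddSubgroup.toZModSubmodule 3 (selmerGroup (W.baseChange K) ((3 ^ 1 : ℕ) : ℤ)))) := by
  sorry
/-- **stub S1 — THE BOTTOM BASE CASE, PINNED: SELMER RANK ONE ⟹ `c(1) = δ(y_K) ≢ 0 (mod 3)`** (koly3b (R-e), plan
g27 23:40:43Z). At every Hoffstein–Luo A1 frame with `dim_𝔽₃ Sel₃(E/K) = 1` there is a conductor-`1` Kolyvagin–Heegner
datum (it exists by CM theory, `exists_kolyvaginHeegnerData_one`; its class is `δ(y_K) ∈ H¹(K, E[3])` for every choice of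
the irrelevant fields) whose Kolyvagin class mod 3 is NON-ZERO — equivalently `y_K ∉ 3·E(K)`, `3 ∤ [E(K) : ℤ y_K]`, given
`rank E(K) = 1`, `E(K)[3] = 0` and hence `Ш(E/K)[3] = 0` on this slice. This is W. Zhang's theorem at Selmer rank `r = 1`
(`M_{r−1} = M₀ = 0`): in print (p ≥ 5) = ONE level-raising step at a u-admissible `q₁` killing `Sel`, the rank-0 converse
for the raised form `g_{q₁}` (Thm 7.2 ⟸ Skinner–Urban) and the first reciprocity law `loc_{q₁} c(1) ↔ L(g_{q₁}/K, 1)`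
(Thm 4.1 ∕ BD05); at `p = 3 ∥ N` NOT in print (R-SU3 + B♭ + Jochnowitz@3), also implied by the IMC-side divisibility of the
BSD formula over `K` on the slice (sibling cruxes `HalvesTamAtThree` ∕ `IMCDivTwoLociTamAtThree`: `I_K² ∣₃ #Ш·∏c_v`), and on
A1 ∩ non-split-3 by Schneider@3 (koly3b g0 p456367). Per-pair certificate: the Heegner index mod 3 (no derived classes).
NOT cheap from the crux (a witness `c(n) ≢ 0` with `n ≠ 1` gives `c(1) ≢ 0` only through Kolyvagin's structure theorem).
The `ZMod 3`-structure on `H¹(K, E[3])` is an instance binder (all such structures agree), as in stub P.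
[cite: WZhang2014, Thm. 9.1 with Thm. 7.2 and Thm. 4.1 (case r = 1)] [cite: GrossLMS1991, §4 (P_1 = y_K), Prop. 2.3] -/
theorem stub_bottomRankOneAtThree :
    ∀ (W : WeierstrassCurve ℚ) [W.IsElliptic] [W.IsGloballyMinimal] [NeZero (W.conductorNorm ℤ)] (K : Type)
      [Field K] [NumberField K] (Dt : ModularParametrizationData W (W.conductorNorm ℤ)) (β : ℤ) (ι : K →+* ℂ),
      Summit.BirchSwinnertonDyer.Rank1Residual.ClassX11b W 3 → W.HasMultiplicativeReductionAtPrime 3 →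
      Rank1Residual.Surj W 3 → Rank1Residual.Ram W 3 → ¬ 3 ∣ W.tamagawaProduct → IsImaginaryQuadratic K →
      Odd (NumberField.discr K) → SatisfiesHeegnerHypothesis (W.conductorNorm ℤ) K →
      (W.quadraticTwist (NumberField.discr K : ℚ)).entireLFunction 1 ≠ 0 → NumberField.discr K ≠ -3 →
      (4 * (W.conductorNorm ℤ : ℤ)) ∣ β ^ 2 - NumberField.discr K → ¬ (3 : ℤ) ∣ Dt.c →
      ∀ [Module (ZMod 3) (V3 W K)],
      finrank (ZMod 3)
        (AddSubgroup.toZModSubmodule 3 (selmerGroup (W.baseChange K) ((3 ^ 1 : ℕ) : ℤ))) = 1 →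
      ∃ d : KolyvaginHeegnerData Dt β ι 1, d.kolyvaginClass Nat.prime_three 1 ≠ 0 := by
  sorry

/-- **stub S2-KS — W. ZHANG'S LEVEL KOLYVAGIN SYSTEMS AT `p = 3`** (NEW in v3, RESIDUAL: the R-c content of v2z's S2
and nothing else). At every Hoffstein–Luo A1 frame, for complex conjugation `c ≠ 1` and the `ZMod 3`-structure of
`H¹(K, E[3])`, there is a `Method2.LevelKolyvaginSystem W K Dt β ι c` (tree `KolyvaginRoadThreeMethod2LevelSystems`):
classes `κ m n ∈ H¹(K, E[3])` for every finite set `n` of unipotent-admissible primes and every finite set `m` of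
Kolyvagin primes (Zhang's `c(∏m, ∏n)` on `X_{N⁺, N⁻∏n}` ∕ its Shimura set, transported to `H¹(K, E[3])` by
`A_n[𝔭_n] ≅ E[3]`), with: REALISATION at `n = ∅` (the frame's Kolyvagin classes mod 3); at every GOOD NON-EMPTY level the
KOLYVAGIN-SYSTEM AXIOMS for the level-`n` structure [§8.1 property (1): sign `ε₀ n·(−1)^{#m}`; E's Kummer condition at
the infinite places and at the finite places above no prime of `m ∪ n` (at `3 ∥ N` this includes the identification of
the local conditions of `A_n` and `E` at `3` and at the bad primes — Zhang's Hyp ♥ ∕ Lemma 5.1 analogue, the frame's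
(ram) + `3 ∤ ∏c_ℓ` + `ρ̄` onto); ORDINARY at the places of `n`; TRANSVERSE (`Method2.transverseLocalKer`) at the places of
`m`; and (8.1) `loc_ℓ κ(mℓ, n) = 0 ⟺ loc_ℓ κ(m, n) = 0`]; the (A2) congruence TRANSPORT along two good steps [Thm 4.3:
BD05 reciprocity laws + Ihara ∕ multiplicity one at `3 ∥ N`]; the (A5) BASE CASE `κ(1, n) ≠ 0` at good non-empty even
levels of canonical rank one [Thm 7.2: rank-0 converse (R-SU3 + B♭) + first reciprocity law (Jochnowitz at 3)]. NOT in
print at `p = 3` (W. Zhang §3, Thm 2.1, Thm 4.3, Thm 7.2 are printed for `p ≥ 5`); = the koly memo chain's content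
above the bottom. JUNK: see the module docstring (κ above `∅` is tied to the level structure at EVERY good non-empty
level, across conductors by (8.1), and to the pinned bottom by transport). [cite: WZhang2014, §3.9 (3.30), §8.1, Thm.
2.1, Thm. 4.3, Thm. 7.2, §9 proof of Thm. 9.1] [cite: BertoliniDarmon2005, Thm. 3.2, §9] -/
theorem stub_levelKolyvaginSystemsAtThree :
    ∀ (W : WeierstrassCurve ℚ) [W.IsElliptic] [W.IsGloballyMinimal] [NeZero (W.conductorNorm ℤ)] (K : Type)
      [Field K] [NumberField K] (Dt : ModularParametrizationData W (W.conductorNorm ℤ)) (β : ℤ) (ι : K →+* ℂ),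
      Summit.BirchSwinnertonDyer.Rank1Residual.ClassX11b W 3 → W.HasMultiplicativeReductionAtPrime 3 →
      Rank1Residual.Surj W 3 → Rank1Residual.Ram W 3 → ¬ 3 ∣ W.tamagawaProduct → IsImaginaryQuadratic K →
      Odd (NumberField.discr K) → SatisfiesHeegnerHypothesis (W.conductorNorm ℤ) K →
      (W.quadraticTwist (NumberField.discr K : ℚ)).entireLFunction 1 ≠ 0 → NumberField.discr K ≠ -3 →
      (4 * (W.conductorNorm ℤ : ℤ)) ∣ β ^ 2 - NumberField.discr K → ¬ (3 : ℤ) ∣ Dt.c →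
      ∀ (c : K ≃ₐ[ℚ] K), c ≠ 1 → ∀ [Module (ZMod 3) (V3 W K)],
      Nonempty (LevelKolyvaginSystem W K Dt β ι c) := by
  sorry

/-- **stub S2-ENGINE — THE METHOD ENGINE INSTANTIATED: level Kolyvagin systems + (A1) + odd rank `≥ 3` ⟹ a non-zero
Kolyvagin class** (v3; since v3.1 NO LONGER A STUB; in v3.2 DERIVED below from THEOREMS ONLY — koly3b g10's `PTAt.stub_inductionOfLevelSystemsAtThree_holds`, fed by koly g20's Milne I 4.10(b) for E[3] and zhang3-p1 g10's rigidity p531202). At every Hoffstein–Luo A1 frame: a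
`LevelKolyvaginSystem`, stub A's (A1) rank lowering at the frame (hypothesis, verbatim as in v2z's S2) and
`dim_𝔽₃ Sel₃(E/K)` odd and `≥ 3` give some non-zero Kolyvagin class `c(∏m) mod 3` of the frame. Road: the engine-of-KS
`ZhangTriangulation.exists_ne_zero_of_zhangInduction_on_of_kolyvaginSystem_finite` (p493797; (A3) DERIVED, koly3b
p481938 ∕ zhang3-p1 p493507, no finiteness posit) on the parity-coherent good levels, with its level-independent inputs
DISCHARGED in the model: membership dictionaries for `SelQ` ∕ `SelRelQ` ∕ `baseLocusQ` through
`galoisCohomology.localization` (two-model comparison `Iso.exists_addMonoidHom_comp_localization_eq_torsionLocMap` +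
`torsionPointsMap_bijective`), (REC) (`poitouTate_sum_localTatePairing_eq_zero_of_isTotallyComplex`), isotropy of the
Kummer ∕ ordinary ∕ transverse conditions, (Perf) ∕ (Line) at Kolyvagin primes (`H¹(K_λ, E[3]) = H¹_f ⊕ H¹_tr`,
eigen-lines `f^s × tr^s → 𝔽₃` perfect), (Cheb) ×2 (McCallum Cor 3.2 for eigenclasses, kernel mod
`chebotarev_artinRep`), (Supply) (Zhang L.8.2 ∕ koly3b g4 over `LocalInvariants.SelmerComplement`), (A4) `relaxation_le`,
(A6) from the oddness hypothesis by (A1)'s bookkeeping; the witness `(n, d)` from `realisation` at the conductor `∏ m`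
(`KolSupp` of a product of Kolyvagin primes). [cite: WZhang2014, §9 proof of Thm. 9.1, Lemma 8.4, §8.1]
[cite: McCallumLMS1991, Prop. 3.1, Lemma 5.3] [cite: MilneADT2006, Ch. I, Thm. 4.10] -/
theorem stub_inductionOfLevelSystemsAtThree :
    ∀ (W : WeierstrassCurve ℚ) [W.IsElliptic] [W.IsGloballyMinimal] [NeZero (W.conductorNorm ℤ)] (K : Type)
      [Field K] [NumberField K] (Dt : ModularParametrizationData W (W.conductorNorm ℤ)) (β : ℤ) (ι : K →+* ℂ),
      Summit.BirchSwinnertonDyer.Rank1Residual.ClassX11b W 3 → W.HasMultiplicativeReductionAtPrime 3 →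
      Rank1Residual.Surj W 3 → Rank1Residual.Ram W 3 → ¬ 3 ∣ W.tamagawaProduct → IsImaginaryQuadratic K →
      Odd (NumberField.discr K) → SatisfiesHeegnerHypothesis (W.conductorNorm ℤ) K →
      (W.quadraticTwist (NumberField.discr K : ℚ)).entireLFunction 1 ≠ 0 → NumberField.discr K ≠ -3 →
      (4 * (W.conductorNorm ℤ : ℤ)) ∣ β ^ 2 - NumberField.discr K → ¬ (3 : ℤ) ∣ Dt.c →
      ∀ (c : K ≃ₐ[ℚ] K), c ≠ 1 → ∀ [Module (ZMod 3) (V3 W K)],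
      LevelKolyvaginSystem W K Dt β ι c →
      -- (A1) at the frame (stub A's body, verbatim) as HYPOTHESIS
      (∀ (n : Finset {q // IsUAdmissiblePrime W K q}) (μ : Bool) (x : V3 W K),
        GoodLevel W K n → x ∈ SelQ W K c n μ → x ≠ 0 →
        ∃ q : {q // IsUAdmissiblePrime W K q}, q ∉ n ∧ GoodLevel W K (insert q n) ∧
          x ∉ SelQ W K c (insert q n) μ ∧
          SelQ W K c (insert q n) μ ≤ SelQ W K c n μ ∧
          finrank (ZMod 3) (SelQ W K c (insert q n) μ) + 1 = finrank (ZMod 3) (SelQ W K c n μ) ∧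
          SelQ W K c (insert q n) (!μ) = SelQ W K c n (!μ)) →
      Odd (finrank (ZMod 3)
        (AddSubgroup.toZModSubmodule 3 (selmerGroup (W.baseChange K) ((3 ^ 1 : ℕ) : ℤ)))) →
      3 ≤ finrank (ZMod 3)
        (AddSubgroup.toZModSubmodule 3 (selmerGroup (W.baseChange K) ((3 ^ 1 : ℕ) : ℤ))) →
      ∃ (n : ℕ) (d : KolyvaginHeegnerData Dt β ι n),
        KolyvaginDescent.KolSupp (Zhang2014.IsKolyvaginPrime (W.conductorNorm ℤ) W K 3) n ∧
          d.kolyvaginClass Nat.prime_three 1 ≠ 0 :=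
  -- DERIVED FROM THEOREMS ONLY (v3.2): koly3b g10 part 7 — the registered text with NO named hypothesis (twins of the
  -- S2-ENGINE chain with `hPT ↦ hE3`, `hE3 :=` koly g20 `KolyvaginRoadThreePT.middleExact_canonical_torsionGaloisModule`).
  Summit.BirchSwinnertonDyer.Rank1Residual.X11b.Three.Koly.PTAt.stub_inductionOfLevelSystemsAtThree_holds


/-- **v2z's S2 `stub_inductionRankGeThreeAtThree` — NO LONGER A STUB**: W. Zhang's induction above the bottom (Selmer rank
odd and `≥ 3`, given (A1)) from S2-KS (the level Kolyvagin systems exist) and S2-ENGINE (the instantiated engine). Text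
VERBATIM v2z's, so `ZhangSharpFrameAtThreeHL_of` below is unchanged. [cite: WZhang2014, §9 proof of Thm. 9.1] -/
theorem stub_inductionRankGeThreeAtThree :
    ∀ (W : WeierstrassCurve ℚ) [W.IsElliptic] [W.IsGloballyMinimal] [NeZero (W.conductorNorm ℤ)] (K : Type)
      [Field K] [NumberField K] (Dt : ModularParametrizationData W (W.conductorNorm ℤ)) (β : ℤ) (ι : K →+* ℂ),
      Summit.BirchSwinnertonDyer.Rank1Residual.ClassX11b W 3 → W.HasMultiplicativeReductionAtPrime 3 →
      Rank1Residual.Surj W 3 → Rank1Residual.Ram W 3 → ¬ 3 ∣ W.tamagawaProduct → IsImaginaryQuadratic K →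
      Odd (NumberField.discr K) → SatisfiesHeegnerHypothesis (W.conductorNorm ℤ) K →
      (W.quadraticTwist (NumberField.discr K : ℚ)).entireLFunction 1 ≠ 0 → NumberField.discr K ≠ -3 →
      (4 * (W.conductorNorm ℤ : ℤ)) ∣ β ^ 2 - NumberField.discr K → ¬ (3 : ℤ) ∣ Dt.c →
      ∀ (c : K ≃ₐ[ℚ] K), c ≠ 1 → ∀ [Module (ZMod 3) (V3 W K)],
      -- (A1) at the frame (stub A's body, verbatim) as HYPOTHESIS
      (∀ (n : Finset {q // IsUAdmissiblePrime W K q}) (μ : Bool) (x : V3 W K),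
        GoodLevel W K n → x ∈ SelQ W K c n μ → x ≠ 0 →
        ∃ q : {q // IsUAdmissiblePrime W K q}, q ∉ n ∧ GoodLevel W K (insert q n) ∧
          x ∉ SelQ W K c (insert q n) μ ∧
          SelQ W K c (insert q n) μ ≤ SelQ W K c n μ ∧
          finrank (ZMod 3) (SelQ W K c (insert q n) μ) + 1 = finrank (ZMod 3) (SelQ W K c n μ) ∧
          SelQ W K c (insert q n) (!μ) = SelQ W K c n (!μ)) →
      Odd (finrank (ZMod 3)
        (AddSubgroup.toZModSubmodule 3 (selmerGroup (W.baseChange K) ((3 ^ 1 : ℕ) : ℤ)))) →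
      3 ≤ finrank (ZMod 3)
        (AddSubgroup.toZModSubmodule 3 (selmerGroup (W.baseChange K) ((3 ^ 1 : ℕ) : ℤ))) →
      ∃ (n : ℕ) (d : KolyvaginHeegnerData Dt β ι n),
        KolyvaginDescent.KolSupp (Zhang2014.IsKolyvaginPrime (W.conductorNorm ℤ) W K 3) n ∧
          d.kolyvaginClass Nat.prime_three 1 ≠ 0 := by
  intro W _ _ _ K _ _ Dt β ι hX hmult hsurj hram htam hK hodd hH hLt h3 hβ hc c hc1 _ hA1 hPar h3le
  obtain ⟨S⟩ := stub_levelKolyvaginSystemsAtThree W K Dt β ι hX hmult hsurj hram htam hK hodd hH hLt h3 hβ hc c hc1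
  exact stub_inductionOfLevelSystemsAtThree W K Dt β ι hX hmult hsurj hram htam hK hodd hH hLt h3 hβ hc c hc1 S hA1
    hPar h3le

/-! ## §3 Composition -/

/-- Complex conjugation exists: an imaginary quadratic field has an automorphism `≠ 1` (`|Aut(K/ℚ)| = 2`).
[folklore] -/
theorem exists_algEquiv_ne_one (K : Type) [Field K] [NumberField K] (hK : IsImaginaryQuadratic K) :
    ∃ c : K ≃ₐ[ℚ] K, c ≠ 1 := by
  haveI : Algebra.IsQuadraticExtension ℚ K := ⟨hK.1⟩
  have hcard : Nat.card (K ≃ₐ[ℚ] K) = 2 := by rw [IsGalois.card_aut_eq_finrank, hK.1]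
  haveI : Finite (K ≃ₐ[ℚ] K) := Nat.finite_of_card_ne_zero (by rw [hcard]; decide)
  haveI : Nontrivial (K ≃ₐ[ℚ] K) := Finite.one_lt_card_iff_nontrivial.mp (by rw [hcard]; decide)
  exact exists_ne 1

/-- **Composition (sorry-free): the crux BY NAME from the stubs BY NAME, by the PARITY CASE SPLIT on
`dim_𝔽₃ Sel₃(E/K)`.** At each HL frame: complex conjugation `c ≠ 1`, the `ZMod 3`-structure of `H¹(K, E[3])`
(`zsmul_discreteH1_torsion`); stub P makes the 3-Selmer rank odd, so it is `1` — then stub S1 gives the conductor-1 class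
`c(1) ≢ 0`, a Kolyvagin-supported witness with `n = 1` (`kolSupp_one`) — or `≥ 3` — then stub S2, fed with stub A's
(A1) at the frame and the parity, gives the witness. [cite: WZhang2014, §9 proof of Thm. 9.1 and Thm. 9.2] -/
theorem ZhangSharpFrameAtThreeHL_of :
    Summit.BirchSwinnertonDyer.BirchSwinnertonDyer.Theses.KolyvaginRoadThree.ZhangSharpFrameAtThreeHL := by
  intro W _ _ _ K _ _ Dt β ι hX hmult hsurj hram htam hK hodd hH hLt h3 hβ hc
  obtain ⟨c, hc1⟩ := exists_algEquiv_ne_one K hK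
  -- the unique `ZMod 3`-module structure on `H¹(K, E[3])`
  letI : Module (ZMod 3) (V3 W K) :=
    AddCommGroup.zmodModule (fun x ↦ by
      have h := zsmul_discreteH1_torsion ((3 ^ 1 : ℕ) : ℤ) x
      rw [natCast_zsmul] at h
      simpa using h)
  have hPar := stub_oddSelmerRankAtThree W K Dt β ι hX hmult hsurj hram htam hK hodd hH hLt h3 hβ hc
  by_cases h1 : finrank (ZMod 3)
        (AddSubgroup.toZModSubmodule 3 (selmerGroup (W.baseChange K) ((3 ^ 1 : ℕ) : ℤ))) = 1
  · -- Selmer rank one: the bottom base case, witness `n = 1`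
    obtain ⟨d, hd⟩ := stub_bottomRankOneAtThree W K Dt β ι hX hmult hsurj hram htam hK hodd hH hLt h3 hβ hc h1
    exact ⟨1, d, KolyvaginDescent.kolSupp_one _, hd⟩
  · -- Selmer rank odd and `≠ 1`, hence `≥ 3`: Zhang's induction above the bottom, fed with (A1)
    have hA1 := stub_levelRaisingAtThree W K Dt β ι hX hmult hsurj hram htam hK hodd hH hLt h3 hβ hc c hc1
    have h3le : 3 ≤ finrank (ZMod 3)
        (AddSubgroup.toZModSubmodule 3 (selmerGroup (W.baseChange K) ((3 ^ 1 : ℕ) : ℤ))) := by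
      obtain ⟨k, hk⟩ := hPar
      omega
    exact stub_inductionRankGeThreeAtThree W K Dt β ι hX hmult hsurj hram htam hK hodd hH hLt h3 hβ hc c hc1 hA1
      hPar h3le

/-! ## §4 BC5 rungs (T3) — TWO rung stubs with CLOSED texts, LANDABLE BY NAME (v2x; koly g12 after zhang3-p1 g6's
RUNG-BY-NAME kit `zhang3/skel/RungByName-19574.lean`, evidence #31). The v3…v2w rung `stub_rung_347253a1` asked the
crux's instance at 347253a1 OUTRIGHT (no published-input binders) and could never be marked `stubs[].landed`. v2x keeps
the NAME `stub_rung_347253a1` (plan g25 condition (β): KOLY's T3 anchor) with the CLOSED text (a″) = PUB binders + ONE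
attested Kolyvagin certificate package ⟹ the crux's instance at every HL frame of 347253a1 ⊗ ℚ(√−11) — EXACTLY the
type of the tribunal-passed fit witness `Koly.Rung347253a1.rung_347253a1_of_cert` (zhang3-p1 g4 p443855; kit
j249662 ∕ j250956; NON-split 3) — and ADDS `stub_rung_5709e1` = the same shape at the SPLIT-at-3 pair 5709e1 ⊗ ℚ(√−83)
(zhang3-p1 g6 p463552 `Koly.Rung5709e1.stub_rung_5709e1_of_cert`; kit j250992; N = 5709, a₃ = +1), i.e. the Kolyvagin
lever where the cyclotomic road (a) does not reach (plan g26 17:17:11Z (3)(c); koly3b (ii)). The curves enter as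
`W = ⟨a₁,…,a₆⟩` hypotheses (no local `def`), so a `Theorems/` file can state each text verbatim. Neither rung is used by
`ZhangSharpFrameAtThreeHL_of`. The route's `tribunal_fit.witness` field is untouched (planner ∕ J). -/

/-- **stub (BC5 rung, NON-split 3): Kolyvagin's conjecture mod 3 at every HL frame of 347253a1 ⊗ ℚ(√−11)** from the
published inputs + ONE attested certificate package (d_K = −11, ℓ = 2: `P(2) ∉ 3·E(K₀[2])`, kit j249662 ∕ j250956).
[cite: Cremona1997, Table 1 (347253a1)] [cite: McCallumLMS1991, §5 Cor. 5.6] -/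
theorem stub_rung_347253a1 :
    ∀ (W : WeierstrassCurve ℚ), W = ⟨0, -1, 1, -10493, 412556⟩ →
      ∀ [W.IsElliptic] [W.IsGloballyMinimal] [NeZero (W.conductorNorm ℤ)],
      (∀ (K : Type) [Field K] [NumberField K], gross_zagier (W.conductorNorm ℤ) W K) →
      (∀ (K : Type) [Field K] [NumberField K], kolyvagin (W.conductorNorm ℤ) W K) →
      (∀ (K : Type) [Field K] [NumberField K], Kolyvagin1990_padicValNat_card_sha_le (W.conductorNorm ℤ) W K) →
      Skinner2016.thmC_padicValRat_bsd_rank_zero → rank_eq_analyticRank_of_analyticRank_le_one →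
      hasEntireLFunction_rat →
      (∀ (K : Type) [Field K] [NumberField K], heegnerPointOfConductor_one_galoisConj (W.conductorNorm ℤ) W K) →
      (∀ (K : Type) [Field K] [NumberField K],
        phi_heegnerPointOfConductor_mem_range_map_ringClassField (W.conductorNorm ℤ) W K) →
      (∀ (K : Type) [Field K] [NumberField K], exists_generator_ringClassGalOver K) →
      McCallum1991_pow_dvd_card_sha_primary_of_certificate →
      McCallum1991_padicValNat_card_sha_primary_add_le_of_globalDivisibility →
      ∀ (K₀ : Type) [Field K₀] [NumberField K₀] (Dt₀ : ModularParametrizationData W (W.conductorNorm ℤ)) (β₀ : ℤ)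
        (ι₀ : K₀ →+* ℂ), IsImaginaryQuadratic K₀ → NumberField.discr K₀ = -11 →
        SatisfiesHeegnerHypothesis (W.conductorNorm ℤ) K₀ →
        (W.quadraticTwist (NumberField.discr K₀ : ℚ)).entireLFunction 1 ≠ 0 → ¬ (3 : ℤ) ∣ Dt₀.c →
        Zhang2014.IsKolyvaginPrime (W.conductorNorm ℤ) W K₀ 3 2 →
        ∀ (d₀ : KolyvaginHeegnerData Dt₀ β₀ ι₀ 2), ¬ PDiv d₀ 3 1 →
      ∀ (K : Type) [Field K] [NumberField K] (Dt : ModularParametrizationData W (W.conductorNorm ℤ)) (β : ℤ)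
        (ι : K →+* ℂ), Summit.BirchSwinnertonDyer.Rank1Residual.ClassX11b W 3 → W.HasMultiplicativeReductionAtPrime 3 →
        Rank1Residual.Surj W 3 → Rank1Residual.Ram W 3 → ¬ 3 ∣ W.tamagawaProduct → IsImaginaryQuadratic K →
        Odd (NumberField.discr K) → SatisfiesHeegnerHypothesis (W.conductorNorm ℤ) K →
        (W.quadraticTwist (NumberField.discr K : ℚ)).entireLFunction 1 ≠ 0 → NumberField.discr K = -11 →
        (4 * (W.conductorNorm ℤ : ℤ)) ∣ β ^ 2 - NumberField.discr K → ¬ (3 : ℤ) ∣ Dt.c →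
        ∃ (n : ℕ) (d : KolyvaginHeegnerData Dt β ι n),
          KolyvaginDescent.KolSupp (Zhang2014.IsKolyvaginPrime (W.conductorNorm ℤ) W K 3) n ∧
            d.kolyvaginClass Nat.prime_three 1 ≠ 0 :=
  -- LANDED p467727 (koly g12): `Summit.BirchSwinnertonDyer.Rank1Residual.X11b.Three.Koly.Method2Rungs.stub_rung_347253a1`
  Summit.BirchSwinnertonDyer.Rank1Residual.X11b.Three.Koly.Method2Rungs.stub_rung_347253a1

/-- **stub (BC5 rung, SPLIT 3): Kolyvagin's conjecture mod 3 at every HL frame of 5709e1 ⊗ ℚ(√−83)** (N = 3·11·173,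
a₃ = +1, ∏c = 1) from the published inputs + ONE attested certificate package (d_K = −83, ℓ = 2, kit j250992).
[cite: Cremona1997, Table 1 (5709e1)] [cite: McCallumLMS1991, §5 Cor. 5.6] -/
theorem stub_rung_5709e1 :
    ∀ (W : WeierstrassCurve ℚ), W = ⟨0, 1, 1, -107, 392⟩ →
      ∀ [W.IsElliptic] [W.IsGloballyMinimal] [NeZero (W.conductorNorm ℤ)],
      (∀ (K : Type) [Field K] [NumberField K], gross_zagier (W.conductorNorm ℤ) W K) →
      (∀ (K : Type) [Field K] [NumberField K], kolyvagin (W.conductorNorm ℤ) W K) →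
      (∀ (K : Type) [Field K] [NumberField K], Kolyvagin1990_padicValNat_card_sha_le (W.conductorNorm ℤ) W K) →
      Skinner2016.thmC_padicValRat_bsd_rank_zero → rank_eq_analyticRank_of_analyticRank_le_one →
      hasEntireLFunction_rat →
      (∀ (K : Type) [Field K] [NumberField K], heegnerPointOfConductor_one_galoisConj (W.conductorNorm ℤ) W K) →
      (∀ (K : Type) [Field K] [NumberField K],
        phi_heegnerPointOfConductor_mem_range_map_ringClassField (W.conductorNorm ℤ) W K) →
      (∀ (K : Type) [Field K] [NumberField K], exists_generator_ringClassGalOver K) →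
      McCallum1991_pow_dvd_card_sha_primary_of_certificate →
      McCallum1991_padicValNat_card_sha_primary_add_le_of_globalDivisibility →
      ∀ (K₀ : Type) [Field K₀] [NumberField K₀] (Dt₀ : ModularParametrizationData W (W.conductorNorm ℤ)) (β₀ : ℤ)
        (ι₀ : K₀ →+* ℂ), IsImaginaryQuadratic K₀ → NumberField.discr K₀ = -83 →
        SatisfiesHeegnerHypothesis (W.conductorNorm ℤ) K₀ →
        (W.quadraticTwist (NumberField.discr K₀ : ℚ)).entireLFunction 1 ≠ 0 → ¬ (3 : ℤ) ∣ Dt₀.c →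
        Zhang2014.IsKolyvaginPrime (W.conductorNorm ℤ) W K₀ 3 2 →
        ∀ (d₀ : KolyvaginHeegnerData Dt₀ β₀ ι₀ 2), ¬ PDiv d₀ 3 1 →
      ∀ (K : Type) [Field K] [NumberField K] (Dt : ModularParametrizationData W (W.conductorNorm ℤ)) (β : ℤ)
        (ι : K →+* ℂ), Summit.BirchSwinnertonDyer.Rank1Residual.ClassX11b W 3 → W.HasMultiplicativeReductionAtPrime 3 →
        Rank1Residual.Surj W 3 → Rank1Residual.Ram W 3 → ¬ 3 ∣ W.tamagawaProduct → IsImaginaryQuadratic K →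
        Odd (NumberField.discr K) → SatisfiesHeegnerHypothesis (W.conductorNorm ℤ) K →
        (W.quadraticTwist (NumberField.discr K : ℚ)).entireLFunction 1 ≠ 0 → NumberField.discr K = -83 →
        (4 * (W.conductorNorm ℤ : ℤ)) ∣ β ^ 2 - NumberField.discr K → ¬ (3 : ℤ) ∣ Dt.c →
        ∃ (n : ℕ) (d : KolyvaginHeegnerData Dt β ι n),
          KolyvaginDescent.KolSupp (Zhang2014.IsKolyvaginPrime (W.conductorNorm ℤ) W K 3) n ∧
            d.kolyvaginClass Nat.prime_three 1 ≠ 0 :=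
  -- LANDED p467727 (koly g12): `Summit.BirchSwinnertonDyer.Rank1Residual.X11b.Three.Koly.Method2Rungs.stub_rung_5709e1`
  Summit.BirchSwinnertonDyer.Rank1Residual.X11b.Three.Koly.Method2Rungs.stub_rung_5709e1

end Summit.BirchSwinnertonDyer.BirchSwinnertonDyer.Cruxes.ZhangSharpFrameAtThreeHL.Method2
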